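import Literature.IUT.HodgeArakelov.ModelCyclotomesLDeltaQuot
import Literature.IUT.HodgeArakelov.MonoThetaFromGroupsProofsTate
import Literature.AnabelianGeometry.EtaleTheta.Discharge.Sec1DeltaThetaZHat
import HarnessLib

/-!
# Bridge B8, part 5a (companion): "`(l·Δ_Θ)(M) ≅ Ẑ(1)`" for the [EtTh] MODEL — the binder `hZ` ELIMINATED
# (proof-only; GAP-LEDGER row G-w4d021-1 CLOSED modulo the §2-chain binder `hYcl` = row G-w4d021-2)

[IUTchII] Def. 1.1 (i) (kurims p. 21): "a subquotient `(l·Δ_Θ)(M)` of `Π_Y(M)` … abstractly isomorphic to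
`Ẑ(1)`" [claim: Mochizuki2012, status: disputed] (IUTchII §1 Def 1.1 (i), kurims p.21); [EtTh] §1 p. 12:
"`(Ẑ(1) ≅) Δ_Θ`" [cite: MochizukiEtTh2009, §1 p.12]. The Tate-curve forms of [IUTchII] Prop. 1.2 (i)/(ii)
(`MonoThetaFromGroupsProofsTate.lean`, abc-iut-w4-d008) and bridge B8 part 6 (`ModelDef11Output`,
abc-iut-L6-d6, item G3) carry the hypothesis binder
`hZ : Nonempty (ModelCyclotomes.lDeltaQuot (C.rigidData μ hC hS h15 L) ≃* ZHat)` (audit W4D021-TATE-N1,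
GAP-LEDGER row G-w4d021-1). This file PROVES it from hypotheses those theorems ALREADY carry —
`IsEtThOrigin` ("`Δ_X` is a profinite free group on 2 generators", p. 12) and `hYcl` ("the image of `Δ^tp_Y`
in `Δ^Θ_X` is closed", pp. 12–13; row G-w4d021-2) — plus `l ≠ 0` (they have `l.Prime`):

* `ModelCyclotomes.nonempty_lDeltaQuot_rigidData_mulEquiv_zHat` — the binder `hZ` as a THEOREM;
* `ThetaSetting.exists_envOfGroup_indeterminacy_ofDoubleUnderline_of_origin`,
  `ThetaSetting.exists_envOfFrobenioid_indeterminacy_ofDoubleUnderline_of_origin` — the `hZ`-free forms of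
  abc-iut-w4-d008's [IUTchII] Prop. 1.2 (i)/(ii) existence theorems at the Tate curve (one binder fewer;
  the remaining named inputs are unchanged: `Prop15iii`, `IsEtThOrigin`, `hYcl`, the printed side conditions
  of [IUTchII] §1 p. 20, and a theta cocycle `η`).

Chain (all proof-only, kernel-checked): `lDeltaQuot (rigidData) ≃* l·Δ_Θ` (`ModelCyclotomesLDeltaQuot`, no
hypotheses) `≃* Δ_Θ` (torsion-free `l`-th power map) `≃* [Δ_X,Δ_X]⁻/[[Δ_X,Δ_X],Δ_X]⁻` (tempered transport
under `hYcl`, `Sec1DeltaThetaCommutatorQuotient`) `≃* Ẑ` (finite Heisenberg quotients of the free profinite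
group, `Sec1FreeTwoHeisenbergZHat`, abc-iut-w5-d171). Seat abc-iut-L2-d1 (gen 3); nothing of another seat
edited or restated. HONEST FRAMING: group structure only (no Tate twist); bookkeeping over a refereed
source's typed interface and kernel-checked implications between typed [IUTchII] statements; nothing disputed
is asserted; no side taken on [IUTchIII] Cor. 3.12; typed ≠ discharged for the remaining binders.
-/

noncomputable section

namespace Literature.IUT.HodgeArakelov

open Literature.AnabelianGeometry.EtaleTheta Literature.AnabelianGeometry.SemiGraphs

namespace ModelCyclotomes

variable {p : ℕ} [Fact p.Prime] {D : Literature.AnabelianGeometry.EtaleTheta.ThetaSetting p}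
  {E : D.EtaleThetaData} {l : ℕ} (C : E.DoubleUnderline l) {N : ℕ+} (μ : D.CyclotomeMod l N)
  (hC : D.Compat) (hS : D.Sec2Hyps)

/-- **"`(l·Δ_Θ)(M) ≅ Ẑ(1)`" for the [EtTh] §1 model** ([IUTchII] Def. 1.1 (i); [EtTh] p. 12): for
`R := C.rigidData μ hC hS h15 L`, the interior cyclotome `lDeltaQuot R = (l·Δ_Θ)/thetaKer` is isomorphic, as an
abstract group, to `Ẑ` — under the freeness guard `IsEtThOrigin`, the closedness binder `hYcl` of the §2
rigidity chain, and `l ≠ 0`. This is the hypothesis `hZ` of `MonoThetaFromGroupsProofsTate.lean`, now a theorem.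
[cite: MochizukiEtTh2009, §1 p.12] -/
theorem nonempty_lDeltaQuot_rigidData_mulEquiv_zHat
    (h15 : Literature.AnabelianGeometry.EtaleTheta.ThetaSetting.Prop15iii E hC) (L : C.CuspLabels)
    (hO : D.IsEtThOrigin)
    (hYcl : (D.DtpY.map D.toHat.toMonoidHom).topologicalClosure ≤
      D.DtpY.map D.toHat.toMonoidHom ⊔ (⁅⁅D.DeltaHat, D.DeltaHat⁆, D.DeltaHat⁆).topologicalClosure)
    (hl : l ≠ 0) :
    Nonempty (lDeltaQuot (C.rigidData μ hC hS h15 L) ≃* Literature.IUT.HodgeTheaters.ZHat) := by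
  obtain ⟨e₁⟩ := nonempty_lDeltaQuot_rigidData_mulEquiv_lDeltaTheta C μ hC hS h15 L
  obtain ⟨e₂⟩ := hO.nonempty_lDeltaTheta_mulEquiv_zHat hYcl hl
  exact ⟨e₁.trans e₂⟩

end ModelCyclotomes

namespace ThetaSetting

section Tate

variable {p : ℕ} [Fact p.Prime] {D : Literature.AnabelianGeometry.EtaleTheta.ThetaSetting p}
  {E : D.EtaleThetaData} {l : ℕ} (C : E.DoubleUnderline l) {N : ℕ+} (μ : D.CyclotomeMod l N)
  (hC : D.Compat) (hS : D.Sec2Hyps)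

/-- **[IUTchII] Prop. 1.2 (i) at the Tate curve, `hZ`-free existence form**: the Prop. 1.2 (i) output with its
isomorphism-indeterminacy clause EXISTS for every topological group `Π ≅ Π^tp_{X̲̲_K}` — abc-iut-w4-d008's
`exists_envOfGroup_indeterminacy_ofDoubleUnderline` with its binder `hZ` ("`(l·Δ_Θ)(M) ≅ Ẑ`") discharged by
`ModelCyclotomes.nonempty_lDeltaQuot_rigidData_mulEquiv_zHat`; remaining inputs `Prop15iii`, `IsEtThOrigin`,
`hYcl`, the printed side conditions of [IUTchII] §1 p. 20 and a theta cocycle.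
[claim: Mochizuki2012, status: disputed] (IUTchII §1 Prop 1.2 (i), kurims p.25) -/
theorem exists_envOfGroup_indeterminacy_ofDoubleUnderline_of_origin
    (h15 : Literature.AnabelianGeometry.EtaleTheta.ThetaSetting.Prop15iii E hC) (L : C.CuspLabels)
    (hl : l.Prime) (hp2 : p ≠ 2) (hpl : p ≠ l) (hζ : ∃ ζ : D.K, IsPrimitiveRoot ζ (4 * l))
    {η : (C.thetaEnvData μ hC hS).PiYdd → MuN p N} (hη : η ∈ (C.thetaEnvData μ hC hS).thetaCocycles)
    (hO : D.IsEtThOrigin)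
    (hYcl : (D.DtpY.map D.toHat.toMonoidHom).topologicalClosure ≤
      D.DtpY.map D.toHat.toMonoidHom ⊔ (⁅⁅D.DeltaHat, D.DeltaHat⁆, D.DeltaHat⁆).topologicalClosure)
    (P : TopGroup.{0}) (hP : Nonempty (P ≃ₜ* (ofDoubleUnderline C μ hC hS hl hp2 hpl hζ hη).PiX)) :
    ∃ Env : EnvOfGroup (ofDoubleUnderline C μ hC hS hl hp2 hpl hζ hη) P, Prop12_i_indeterminacy Env.recon :=
  exists_envOfGroup_indeterminacy_ofDoubleUnderline C μ hC hS h15 L hl hp2 hpl hζ hη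
    (ModelCyclotomes.nonempty_lDeltaQuot_rigidData_mulEquiv_zHat C μ hC hS h15 L hO hYcl hl.ne_zero)
    hO hYcl P hP

/-- **[IUTchII] Prop. 1.2 (ii) at the Tate curve, `hZ`-free form**: for every instance `Fr` of the typer's
interface `TemperedFrobenioidData` over the [IUTchII] §1 setting `ofDoubleUnderline` and every mono-theta
environment `M` of it, an `EnvOfFrobenioid Fr` with `M^Θ(𝒞) = M` whose Def. 1.1 (i) output has the Prop. 1.2 (i)
indeterminacy — abc-iut-w4-d008's `exists_envOfFrobenioid_indeterminacy_ofDoubleUnderline` with `hZ`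
discharged. [claim: Mochizuki2012, status: disputed] (IUTchII §1 Prop 1.2 (ii), kurims pp.25-26) -/
theorem exists_envOfFrobenioid_indeterminacy_ofDoubleUnderline_of_origin
    (h15 : Literature.AnabelianGeometry.EtaleTheta.ThetaSetting.Prop15iii E hC) (L : C.CuspLabels)
    (hl : l.Prime) (hp2 : p ≠ 2) (hpl : p ≠ l) (hζ : ∃ ζ : D.K, IsPrimitiveRoot ζ (4 * l))
    {η : (C.thetaEnvData μ hC hS).PiYdd → MuN p N} (hη : η ∈ (C.thetaEnvData μ hC hS).thetaCocycles)
    (hO : D.IsEtThOrigin)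
    (hYcl : (D.DtpY.map D.toHat.toMonoidHom).topologicalClosure ≤
      D.DtpY.map D.toHat.toMonoidHom ⊔ (⁅⁅D.DeltaHat, D.DeltaHat⁆, D.DeltaHat⁆).topologicalClosure)
    (Fr : TemperedFrobenioidData (ofDoubleUnderline C μ hC hS hl hp2 hpl hζ hη))
    (M : MonoThetaEnv (ofDoubleUnderline C μ hC hS hl hp2 hpl hζ hη)) :
    ∃ Env : EnvOfFrobenioid Fr, Env.env = M ∧ Prop12_i_indeterminacy Env.recon :=
  exists_envOfFrobenioid_indeterminacy_ofDoubleUnderline C μ hC hS h15 L hl hp2 hpl hζ hη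
    (ModelCyclotomes.nonempty_lDeltaQuot_rigidData_mulEquiv_zHat C μ hC hS h15 L hO hYcl hl.ne_zero)
    hO hYcl Fr M

end Tate

end ThetaSetting

end Literature.IUT.HodgeArakelov

end
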